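import Summits.QuantumFields.YangMills.Theorems.BalabanUVNodesN11SpaceTruncationChargedSep
import Literature.MathematicalPhysics.QuantumFieldTheory.Balaban1983to89.B15Claim189LambdaPin

/-!
# DAG node N11 — THE (7)-DATA'S LEVEL-0 CLAUSE FROM THE READING SUPPORT: print's level-0 (7)-plaquettes for the top domain `Ω₀ = suppDom(Ω₁)` TOUCH the collar
# `Ω₀ ∖ Ω₁`, on which the reading support's scale-0 clause already reads `W₀` regular

HEADER — WORK-UNIT METADATA.  Cell `pub-ymgap`, YM-PLAN Track A (HUMAN RULING D-0062), seat `pub-ymgap-dag-n11-d` (g12; R134 fan-out seat N11 [B14], strategy s2),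
route `BalabanUVNodes`, item K1⁷ `StabilityBAtRecordR13SepCoPH` = stmt-QuantumFields-20542 (helper, `--kind proof --supports 20542 --as helper`, count-neutral).
[15] = [Balaban1985Variational], [6] = [Balaban1985RegularSpaces], [III] = [Balaban1988Convergent].  Over def-P11's `Sect2.printedPlaqsTop ∕ DataSmall7PTop`
(`Record12BgRowTopDomain`), def-R's `suppDomOfRecord = hullD M₁ 1 (Ω 1)` (`LargeFieldBackgroundCoPOfRecord`), 12a″'s `readSelOfSeq` (`readSelOfSeq_zero_compl`), and the
cube ∕ cover dictionaries (`B15Claim189LambdaPin.mem_cubeEnl_cubeOfSite_of_near`, `B15Claim189CubePin.cubeOfSite_mem_cubeIndices`, `B14SeparationOfRecord.mem_hullD_iff`).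

WHY THIS FILE.  The junction of the no-expansion 𝐓-step (`…SpaceTruncationChargedSep` ∕ `…ChargedSepJunctionOfSolvable`) carries the (7)-data row `DataSmall7PTop`; its
LEVEL-0 clause asks `W 0` regular on `printedPlaqsTop Ω (suppDom Ω) k` — the fine plaquettes touching `Γ₀ = Ω₁ᶜ` AND the support domain.  The reading support's scale-0 clause
(12a″'s `readSelOfSeq … 0 (Ω 1)ᶜ = Ω₀ ∖ Ω₁`) gives `W 0` regular on the plaquettes touching `Ω₀ ∖ Ω₁`.  This file proves the inclusion `printedPlaqsTop Ω Ω₀ k ⊆ plaqsOf (Ω₀ ∖ Ω 1)`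
whenever every site ADJACENT to `Ω 1` lies in `Ω₀` (true for `Ω₀ = hullD M₁ 1 (Ω 1)`, `1 ≤ M₁`): a plaquette with a corner outside `Ω₁` and a corner in `Ω₀` has, walking along its
boundary, a corner in `Ω₀ ∖ Ω₁`.  So the level-0 clause of the (7)-data row is DISCHARGED from the reading support; the remaining clauses (levels `1 ≤ m+1 ≤ k`, mixed fields)
need the averaging-fibre identity (located, HANDOFF).

WHAT THIS FILE PROVES (0 `sorry`, 0 `def`).
* `coordDist_shift_le_one` — a unit step moves every cyclic coordinate distance by at most `1`.
* `mem_hullD_one_of_adjacent` — a site adjacent to `X` lies in `hullD P s 1 X` (`0 < s`).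
* ★ `printedPlaqsTop_subset_plaqsOf_diff` — `printedPlaqsTop Ω Ω₀ k ⊆ plaqsOf (Ω₀ ∖ Ω 1)` when `Ω₀` contains every site adjacent to `Ω 1` (`0 < k`).
* `adjacent_mem_suppDomOfRecord`; ★★ `plaqSmallOn_printedPlaqsTop_of_readZero` ∕ `…_of_readSel_zero` — the level-0 clause of `DataSmall7PTop … (suppDomOfRecord …) …` from
  the reading support's scale-0 clause (`1 ≤ M₁`, `0 < k`).

HONEST FRAMING.  Helper lane of K1⁷; lattice bookkeeping; nothing of Bałaban's is asserted; the (7)-data row's levels `≥ 1` remain displayed.  N11 NOT discharged; K1⁷ NOT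
closed; counts unmoved (typed 28∕28 · discharged 5∕27).  One finite four-torus programme at fixed `ε = L^{−K}` — NOT ℝ⁴, NOT OS, NOT a mass gap, NOT Clay.  No `sorry`, `axiom`,
`def`, `instance`, `notation`.  Sources (SHAPE only): [15] (3),(7) p.278; [6] (1.3)–(1.6) p.77; [III] (2.2) p.255, (2.10) p.256, p.255 (support).
-/

noncomputable section

open scoped BigOperators

namespace Summit.QuantumFields.YangMills.Theorems.BalabanUVNodesN11Data7TopZeroOfRead

open Literature.MathematicalPhysics.QuantumFieldTheory.Balaban1983to89 T4Continuum Node00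
open B15DeterminingSets B8Eq17ClassAkV1
open B15Claim189LambdaPin (coordDist coordDist_self mem_cubeEnl_cubeOfSite_of_near)
open B15Claim189CubePin (cubeOfSite cubeOfSite_mem_cubeIndices)
open B14SeparationOfRecord (mem_hullD_iff)

variable {P : Params}

/-! ## §1  Adjacency and the one-layer hull -/

/-- A unit step moves every cyclic coordinate distance by at most `1`. [folklore] -/
theorem coordDist_shift_le_one (x : Site P 0) (μ i : Fin P.d) : coordDist (x.shift μ) x i ≤ 1 := by
  unfold coordDist
  by_cases h : i = μ
  · subst h
    refine (min_le_left _ _).trans ?_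
    simp only [Site.shift, Function.update_self, add_sub_cancel_left]
    rw [ZMod.val_one_eq_one_mod]
    exact Nat.mod_le 1 _
  · simp only [Site.shift, Function.update_of_ne h, sub_self, ZMod.val_zero, min_self, Nat.zero_le]

/-- **A SITE ADJACENT TO `X` LIES IN THE ONE-LAYER HULL `hullD P s 1 X`** (`0 < s`): its own `s`-cube, enlarged by one layer, meets `X` at the adjacent point.
[cite: Balaban1988Convergent, p.255 («a layer of M₁-cubes … its support»)] -/
theorem mem_hullD_one_of_adjacent {s : ℕ} (hs : 0 < s) {X : Set (Site P 0)} {x : Site P 0} {μ : Fin P.d}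
    (h : x.shift μ ∈ X ∨ ∃ y ∈ X, y.shift μ = x) : x ∈ hullD P s 1 X := by
  refine mem_hullD_iff.mpr ⟨cubeOfSite s x, cubeOfSite_mem_cubeIndices s hs x, ?_,
    mem_cubeEnl_cubeOfSite_of_near hs fun i => by rw [coordDist_self]; exact Nat.zero_le _⟩
  rcases h with hx | ⟨y, hy, rfl⟩
  · exact ⟨x.shift μ, mem_cubeEnl_cubeOfSite_of_near hs fun i => (coordDist_shift_le_one x μ i).trans (by omega), hx⟩
  · refine ⟨y, mem_cubeEnl_cubeOfSite_of_near hs fun i => ?_, hy⟩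
    -- `coordDist y (y.shift μ) i ≤ 1`
    have h1 := coordDist_shift_le_one y μ i
    unfold coordDist at h1 ⊢
    rw [min_comm]
    exact h1.trans (by omega)

/-! ## §2  The level-0 (7)-plaquettes of the top domain touch the collar `Ω₀ ∖ Ω₁` -/

/-- Unit steps commute. [folklore] -/
private theorem shift_comm {j : ℕ} (x : Site P j) (μ ν : Fin P.d) : (x.shift μ).shift ν = (x.shift ν).shift μ := by
  funext κ
  by_cases hκν : κ = ν
  · subst hκν
    by_cases hκμ : κ = μ
    · subst hκμ; rfl
    · simp [Site.shift, Function.update_apply, hκμ]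
  · by_cases hκμ : κ = μ
    · subst hκμ
      simp [Site.shift, Function.update_apply, hκν]
    · simp [Site.shift, Function.update_apply, hκμ, hκν]

/-- **★ PRINT'S LEVEL-0 (7)-PLAQUETTES FOR THE TOP DOMAIN TOUCH `Ω₀ ∖ Ω₁`**: if every site adjacent to `Ω 1` lies in `Ω₀`, then a fine plaquette touching `Γ₀ = (Ω 1)ᶜ` and
touching `Ω₀` has a corner in `Ω₀ ∖ Ω 1` (`0 < k`; walk the boundary from a corner in `Ω₀` to a corner outside `Ω 1`). [cite: Balaban1985Variational, (7) p.278; Balaban1988Convergent, (2.2) p.255] -/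
theorem printedPlaqsTop_subset_plaqsOf_diff (Ω : ℕ → Set (Site P 0)) (Ω₀ : Set (Site P 0)) {k : ℕ} (hk : 0 < k)
    (hadj : ∀ (x : Site P 0) (μ : Fin P.d), (x.shift μ ∈ Ω 1 → x ∈ Ω₀) ∧ (x ∈ Ω 1 → x.shift μ ∈ Ω₀)) :
    Sect2.printedPlaqsTop Ω Ω₀ k ⊆ plaqsOf (Ω₀ \ Ω 1) := by
  rintro p ⟨⟨hΓ, -⟩, hΩ₀⟩
  have hΓ' : p ∈ plaqsOf ((Ω 1)ᶜ) := by
    have e : genSet Ω k 0 = (Ω 1)ᶜ := by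
      show pts 0 (gammaRegion Ω k 0) = _
      rw [gammaRegion_zero Ω hk, pts_zero]
    rwa [e] at hΓ
  -- from a corner in `Ω 1`, the next corner along a bond is in `Ω 1` or in `Ω₀ ∖ Ω 1`
  have nxt : ∀ (x : Site P 0) (μ : Fin P.d), x ∈ Ω 1 → x.shift μ ∈ Ω 1 ∨ x.shift μ ∈ Ω₀ \ Ω 1 := fun x μ hx => by
    by_cases h : x.shift μ ∈ Ω 1
    · exact Or.inl h
    · exact Or.inr ⟨(hadj x μ).2 hx, h⟩
  have prv : ∀ (x : Site P 0) (μ : Fin P.d), x.shift μ ∈ Ω 1 → x ∈ Ω 1 ∨ x ∈ Ω₀ \ Ω 1 := fun x μ hx => by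
    by_cases h : x ∈ Ω 1
    · exact Or.inl h
    · exact Or.inr ⟨(hadj x μ).1 hx, h⟩
  have hc2 : (p.src.shift p.μ).shift p.ν = (p.src.shift p.ν).shift p.μ := shift_comm p.src p.μ p.ν
  -- not every corner lies in `Ω 1`
  have hnot : ¬ (p.src ∈ Ω 1 ∧ p.src.shift p.μ ∈ Ω 1 ∧ p.src.shift p.ν ∈ Ω 1 ∧ (p.src.shift p.μ).shift p.ν ∈ Ω 1) := by
    rintro ⟨h0, h1, h3, h2⟩
    rcases hΓ' with h | h | h | h
    · exact h h0
    · exact h h1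
    · exact h h3
    · exact h h2
  -- goal: some corner in `Ω₀ ∖ Ω 1`
  show p.src ∈ Ω₀ \ Ω 1 ∨ p.src.shift p.μ ∈ Ω₀ \ Ω 1 ∨ p.src.shift p.ν ∈ Ω₀ \ Ω 1 ∨ (p.src.shift p.μ).shift p.ν ∈ Ω₀ \ Ω 1
  rcases hΩ₀ with h0 | h1 | h3 | h2
  · -- the corner `p₋ ∈ Ω₀`
    by_cases m0 : p.src ∈ Ω 1
    · rcases nxt _ p.μ m0 with m1 | g1
      · rcases nxt _ p.ν m1 with m2 | g2
        · rcases prv (p.src.shift p.ν) p.μ (by rw [← hc2]; exact m2) with m3 | g3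
          · exact absurd ⟨m0, m1, m3, m2⟩ hnot
          · exact Or.inr (Or.inr (Or.inl g3))
        · exact Or.inr (Or.inr (Or.inr g2))
      · exact Or.inr (Or.inl g1)
    · exact Or.inl ⟨h0, m0⟩
  · -- the corner `p₋ + e_μ ∈ Ω₀`
    by_cases m1 : p.src.shift p.μ ∈ Ω 1
    · rcases nxt _ p.ν m1 with m2 | g2
      · rcases prv (p.src.shift p.ν) p.μ (by rw [← hc2]; exact m2) with m3 | g3
        · rcases prv p.src p.ν m3 with m0 | g0
          · exact absurd ⟨m0, m1, m3, m2⟩ hnot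
          · exact Or.inl g0
        · exact Or.inr (Or.inr (Or.inl g3))
      · exact Or.inr (Or.inr (Or.inr g2))
    · exact Or.inr (Or.inl ⟨h1, m1⟩)
  · -- the corner `p₋ + e_ν ∈ Ω₀`
    by_cases m3 : p.src.shift p.ν ∈ Ω 1
    · rcases nxt _ p.μ m3 with m2 | g2
      · rcases prv (p.src.shift p.μ) p.ν (by rw [hc2]; exact m2) with m1 | g1
        · rcases prv p.src p.μ m1 with m0 | g0
          · exact absurd ⟨m0, m1, m3, by rw [hc2]; exact m2⟩ hnot
          · exact Or.inl g0
        · exact Or.inr (Or.inl g1)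
      · exact Or.inr (Or.inr (Or.inr (by rw [hc2]; exact g2)))
    · exact Or.inr (Or.inr (Or.inl ⟨h3, m3⟩))
  · -- the far corner `p₋ + e_μ + e_ν ∈ Ω₀`
    by_cases m2 : (p.src.shift p.μ).shift p.ν ∈ Ω 1
    · rcases prv (p.src.shift p.μ) p.ν m2 with m1 | g1
      · rcases prv p.src p.μ m1 with m0 | g0
        · rcases nxt _ p.ν m0 with m3 | g3
          · exact absurd ⟨m0, m1, m3, m2⟩ hnot
          · exact Or.inr (Or.inr (Or.inl g3))
        · exact Or.inl g0
      · exact Or.inr (Or.inl g1)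
    · exact Or.inr (Or.inr (Or.inr ⟨h2, m2⟩))

/-! ## §3  At the record's support domain: the level-0 clause of the (7)-data row from the reading support's scale-0 clause -/

section Record

variable (F : T4Family) {G : Type*} [GaugeGroup G]

/-- Every site adjacent to `Ω 1` lies in def-R's support domain `suppDomOfRecord = hullD M₁ 1 (Ω 1)` (`1 ≤ M₁`). [cite: Balaban1988Convergent, p.255 (support)] -/
theorem adjacent_mem_suppDomOfRecord (ν : Stage7Numerics) (hM₁ : 1 ≤ ν.M₁) (K : ℕ) (Ω : ℕ → Set (Site (F.P K) 0)) (x : Site (F.P K) 0) (μ : Fin (F.P K).d) :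
    (x.shift μ ∈ Ω 1 → x ∈ suppDomOfRecord F ν K Ω) ∧ (x ∈ Ω 1 → x.shift μ ∈ suppDomOfRecord F ν K Ω) :=
  ⟨fun h => mem_hullD_one_of_adjacent hM₁ (Or.inl h), fun h => mem_hullD_one_of_adjacent hM₁ (Or.inr ⟨x, h, rfl⟩)⟩

/-- **★★ THE LEVEL-0 CLAUSE OF THE (7)-DATA ROW FROM THE READING SUPPORT'S SCALE-0 CLAUSE**: regularity of `W₀` on the plaquettes touching the collar
`suppDom(Ω₁) ∖ Ω₁` (12a″'s scale-0 reading region `readSelOfSeq … 0 (Ω 1)ᶜ`, `readSelOfSeq_zero_compl`) gives regularity on print's level-0 (7)-plaquettes for the top domain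
`suppDom(Ω₁)` (`1 ≤ M₁`, `0 < k`). [cite: Balaban1985Variational, (3),(7) p.278; Balaban1988Convergent, (2.2) p.255, (2.10) p.256, p.255] -/
theorem plaqSmallOn_printedPlaqsTop_of_readZero (ν : Stage7Numerics) (hM₁ : 1 ≤ ν.M₁) (K : ℕ) (Ω : ℕ → Set (Site (F.P K) 0)) {k : ℕ} (hk : 0 < k)
    {δ : ℝ} {W₀ : GaugeField (F.P K) 0 G} (hread : PlaqSmallOn (plaqsOf (suppDomOfRecord F ν K Ω \ Ω 1)) δ W₀) :
    PlaqSmallOn (Sect2.printedPlaqsTop Ω (suppDomOfRecord F ν K Ω) k) δ W₀ :=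
  fun q hq => hread q (printedPlaqsTop_subset_plaqsOf_diff Ω _ hk (adjacent_mem_suppDomOfRecord F ν hM₁ K Ω) hq)

/-- The same keyed on 12a″'s scale-0 reading region of the run (`pts 0 (readSelOfSeq F p (suppDom Ω) Ω 0 (Ω 1)ᶜ)`), the literal shape of the reading support's `j = 0` clause.
[cite: Balaban1985Variational, (7) p.278; Balaban1988Convergent, (2.2) p.255, p.255] -/
theorem plaqSmallOn_printedPlaqsTop_of_readSel_zero (ν : Stage7Numerics) (hM₁ : 1 ≤ ν.M₁) (p : B12.RunParams) (Ω : ℕ → Set (Site (F.P p.K) 0)) {k : ℕ} (hk : 0 < k)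
    {δ : ℝ} {W₀ : GaugeField (F.P p.K) 0 G}
    (hread : PlaqSmallOn (plaqsOf (pts 0 (readSelOfSeq F p (suppDomOfRecord F ν p.K Ω) Ω 0 (Ω (0 + 1))ᶜ))) δ W₀) :
    PlaqSmallOn (Sect2.printedPlaqsTop Ω (suppDomOfRecord F ν p.K Ω) k) δ W₀ := by
  rw [Nat.zero_add, readSelOfSeq_zero_compl, pts_zero] at hread
  exact plaqSmallOn_printedPlaqsTop_of_readZero F ν hM₁ p.K Ω hk hread

end Record

end Summit.QuantumFields.YangMills.Theorems.BalabanUVNodesN11Data7TopZeroOfRead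


end
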